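/-
Copyright (c) 2026 the pub-hodgecm-mathlib formalisation cell (harness21).  Prover seat hodgecm-mathlib-K2E2-p12 (g9), Track B «K2-LIT», h413 = `stmt-HodgeConjecture-24833`,
R90-TF section S8 «ContSpec-n½», deal S8-R149 (1) (n2) (S8 dealer R90-CS-plan (g3)): the z-UNIFORM edition of ★ p863071 — the intertwined part of the constant term of a level ∕ pair
Eisenstein series of `U(2,1)_{L∕L⁺}` is bounded on `{T < H}` UNIFORMLY on compact subsets of the tube: the letter `hMfU` of R90-C133-p02's (α′) tube brick
`K2E1ChiEisensteinPairTruncationTubeCMThree`.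
-/
import Summits.HodgeConjecture.HodgeConjecture.Theorems.K2E1EisensteinConstantTermIntertwinedBoundLevelU3   -- ★ p863071 (this seat): the per-`z` bound and ALL its ★ inputs (CT unfolding, GK₃, Iwasawa, (ν-2), `IsChiSectionPair`)
import Summits.HodgeConjecture.HodgeConjecture.Theorems.K2E1BorelEisensteinRegularCMThree                   -- ★ R4a₃: `rpow_le_rpow_add_rpow` (`h^r ≤ h^{σ₁} + h^{σ₂}` for `σ₁ ≤ r ≤ σ₂`)
import HarnessLib

/-!
# K2·E1 ∕ R90-TF S8 — `K2E1EisensteinConstantTermIntertwinedBoundUniformU3`: `‖E_B(E f_z)(g) − f_z(g)‖ ≤ C′` ON `{T < H}`, UNIFORMLY FOR `z` IN A COMPACT `K ⊂ {2 < Re}` — the letter `hMfU`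

Track B ∕ K2-LIT inside programme R90-TF, section S8 «ContSpec-n½», crux h413 = `stmt-HodgeConjecture-24833`, route of record `HCCMUnconditional`; cell `hodgecm-mathlib`.  Prover seat
`hodgecm-mathlib-K2E2-p12` (g9); S8 dealer R90-CS-plan (g3) S8-R149 (1) (n2).  Consumer: R90-C133-p02 (g0)'s (α′) tube brick `Theorems/K2E1ChiEisensteinPairTruncationTubeCMThree.lean`
(`exists_norm_truncation_le_level_cm_three_uniform` ∕ `exists_toLp_truncation_differentiableOn_level∕pair_cm_three`), whose ONE visible letter
`hMfU : ∀ K, IsCompact K → K ⊆ {2 < Re} → ∃ C′, ∀ z ∈ K, ∀ g, T < H g → ‖E_B(E(φH^z)) g − (φH^z) g‖ ≤ C′` is §1's conclusion token for token.  THEOREMS ONLY (no `def`, no `instance`,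
no notation, no named-fact hypothesis, no `sorry`; default heartbeats); lane `--supports stmt-HodgeConjecture-24833 --as helper` (count-neutral).  Closes no socket.

THE MATHEMATICS ([MoeglinWaldspurger1995, II.1.6–II.1.7]; [GindikinKarpelevich1962]) — ★ p863071 with the `z`-dependence of its constant made explicit.  There, for `2 < Re z` and `T < H(g)`:
`‖E_B(f_z)(g) − f_z(g)‖ ≤ (ν𝓕)⁻¹·M·c(Re z)·H(g)^{2−Re z}` with the Gindikin–Karpelevich constant `c(σ) = ∫_{N(𝔸)} H(w₀ v)^σ dν(v) < ∞` (`σ > 2`).  For `z` in a compact `K ⊂ {2 < Re}` the real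
parts lie in `[σ₁, σ₂] ⊂ (2, ∞)` (`σ₁ = min_K Re`, `σ₂ = max_K Re`, attained); `H(w₀v)^{Re z} ≤ H(w₀v)^{σ₁} + H(w₀v)^{σ₂}` (★ `rpow_le_rpow_add_rpow`, any positive base) gives
`c(Re z) ≤ c(σ₁) + c(σ₂)`, and `H(g)^{2−Re z} ≤ 1` for `H(g) > T ≥ 1`; so `C′ := (ν𝓕)⁻¹·M·(c(σ₁) + c(σ₂))` serves all of `K`.  (No monotonicity `H(w₀v) ≤ 1` is used.)
* §1 **`hMfU_level_cm_three`** — the letter for a continuous bounded left-`N(𝔸)`∕`B(L⁺)`-invariant section `φ`, `1 ≤ T`; **`hMfU_pair_cm_three`** — the same for a `(χ₁, χ₂)`-pair section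
  (★ `IsChiSectionPair`, `χ₂` automorphic).
HONEST LABEL: HC_CM is proved only modulo the 7 printed citations (2 remaining named inputs: hLiu418 = `stmt-HodgeConjecture-24832`, h413 = `stmt-HodgeConjecture-24833`) until rung 0
closes; this file asserts no named fact and closes no socket; unconditional (no letters); count-neutral.
References: [MoeglinWaldspurger1995] II.1.6–II.1.7 · [Garrett2018] §2.8 · [Rogawski1990] §2.2, §13.9 p. 229.
-/

set_option autoImplicit false
set_option linter.dupNamespace false  -- the mandated namespace repeats the single-problem summit's segment (`HodgeConjecture.HodgeConjecture`)

noncomputable section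

open MeasureTheory Measure NumberField IsDedekindDomain Set Filter Metric
open scoped ENNReal NNReal Topology
open Literature.NumberTheory.Automorphic Literature.NumberTheory.Automorphic.UnitaryGroup AdelicGroupData
open Literature.NumberTheory.Automorphic.Arthur2013.Leaves.TECR
open Literature.NumberTheory.GaloisRepresentations (HeckeCharacter)
open Summit.HodgeConjecture.HodgeConjecture.Cruxes.H413.K2E1BorelEisensteinU
open Summit.HodgeConjecture.HodgeConjecture.Cruxes.H413.K2E1CharacterEisensteinU3PairDefs
open Summit.HodgeConjecture.HodgeConjecture.Cruxes.H413.K2E1EisensteinAnalyticBinders (hfin_of_locallyUniformMajorant)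
open Summit.HodgeConjecture.HodgeConjecture.Cruxes.H413.K2E1BorelEisensteinGodementCMThree (exists_locallyUniform_majorant_flatSectionU_cm_three)
open Summit.HodgeConjecture.HodgeConjecture.Cruxes.H413.K2E1HeisenbergHaarU3 (isInvInvariant_of_isHaarMeasure_adelicUnipotent_three)
open Summit.HodgeConjecture.HodgeConjecture.Cruxes.H413.K2E1BorelCosetsDictionary (forall_arithmeticBorel_iff)
open Summit.HodgeConjecture.HodgeConjecture.Cruxes.H413.K2E1ChiEisensteinConstantTermCMThree (borelConstantTerm_eisensteinSeriesU_flatSectionU_cm_three)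
open Summit.HodgeConjecture.HodgeConjecture.Cruxes.H413.K2E1IntertwiningGrowthU3 (integral_borelHeight_weylLongU_mul_rpow_eq integrable_borelHeight_weylLongU_mul_rpow)
open Summit.HodgeConjecture.HodgeConjecture.Cruxes.H413.K2E1BorelEisensteinRegularCMThree (rpow_le_rpow_add_rpow)

namespace Summit.HodgeConjecture.HodgeConjecture.Cruxes.H413.K2E1EisensteinConstantTermIntertwinedBoundUniformU3

variable (L : Type) [Field L] [NumberField L] [IsCMField L]
variable [MeasurableSpace (quasiSplit (↥(maximalRealSubfield L)) L (IsCMField.complexConj L) 3).Adelic] [BorelSpace (quasiSplit (↥(maximalRealSubfield L)) L (IsCMField.complexConj L) 3).Adelic]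

/-- **`hMfU` — THE INTERTWINED PART OF THE CONSTANT TERM IS BOUNDED ON `{T < H}`, UNIFORMLY ON COMPACT `K ⊂ {2 < Re}`**: `ν` Haar on the Heisenberg radical, `𝓕` a fundamental domain of
`N(L⁺)` of compact closure, `φ` CONTINUOUS BOUNDED (`‖φ‖ ≤ M`) left-`N(𝔸)`∕`B(L⁺)`-invariant, `1 ≤ T`: for every compact `K ⊆ {2 < Re}` there is `C′` with `‖E(f_z)_B(g) − f_z(g)‖ ≤ C′`
for all `z ∈ K`, `T < H(g)`.  `C′ = (ν𝓕)⁻¹·M·(c(σ₁) + c(σ₂))`, `σ₁ ≤ Re ≤ σ₂` on `K` (★ p863071's road: Bruhat unfolding ★, domination, Gindikin–Karpelevich ★; uniformity by ★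
`rpow_le_rpow_add_rpow` and `H^{2−Re z} ≤ 1` above the floor). [cite: MoeglinWaldspurger1995, II.1.6–II.1.7] [cite: Garrett2018, §2.8] -/
theorem hMfU_level_cm_three (ν : Measure ↥(adelicUnipotent (↥(maximalRealSubfield L)) L (IsCMField.complexConj L) 3)) [ν.IsHaarMeasure]
    {𝓕 : Set ↥(adelicUnipotent (↥(maximalRealSubfield L)) L (IsCMField.complexConj L) 3)} (h𝓕N : IsFundamentalDomain ↥(rationalUnipotent (↥(maximalRealSubfield L)) L (IsCMField.complexConj L) 3) 𝓕 ν) (h𝓕c : IsCompact (closure 𝓕))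
    {φ : (quasiSplit (↥(maximalRealSubfield L)) L (IsCMField.complexConj L) 3).Adelic → ℂ} (hφc : Continuous φ) {M : ℝ} (hφM : ∀ x, ‖φ x‖ ≤ M)
    (hφN : ∀ (n : ↥(adelicUnipotent (↥(maximalRealSubfield L)) L (IsCMField.complexConj L) 3)) (y : (quasiSplit (↥(maximalRealSubfield L)) L (IsCMField.complexConj L) 3).Adelic),
      φ ((n : (quasiSplit (↥(maximalRealSubfield L)) L (IsCMField.complexConj L) 3).Adelic) * y) = φ y)
    (hφB : ∀ b ∈ borelU ((IsCMField.complexConj L : L ≃ₐ[↥(maximalRealSubfield L)] L) : L →+* L) ((StdForm.antidiagonal 3).over L), ∀ x : (quasiSplit (↥(maximalRealSubfield L)) L (IsCMField.complexConj L) 3).Adelic,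
      φ ((quasiSplit (↥(maximalRealSubfield L)) L (IsCMField.complexConj L) 3).toAdelic b * x) = φ x)
    {T : ℝ≥0} (hT : 1 ≤ T) :
    ∀ K : Set ℂ, IsCompact K → K ⊆ {z : ℂ | 2 < z.re} → ∃ C' : ℝ, ∀ z ∈ K, ∀ g : (quasiSplit (↥(maximalRealSubfield L)) L (IsCMField.complexConj L) 3).Adelic, T < borelHeight g →
      ‖borelConstantTerm ν 𝓕 (eisensteinSeriesU (flatSectionU φ z)) g - flatSectionU φ z g‖ ≤ C' := by
  intro K hK hK2
  rcases K.eq_empty_or_nonempty with rfl | hKne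
  · exact ⟨0, fun z hz => (Set.notMem_empty z hz).elim⟩
  haveI := t2Space_adeleRing_of_numberField L
  haveI := locallyCompactSpace_adeleRing' L
  haveI : T2Space (quasiSplit (↥(maximalRealSubfield L)) L (IsCMField.complexConj L) 3).Adelic := inferInstanceAs (T2Space (adelic (↥(maximalRealSubfield L)) L (IsCMField.complexConj L) 3 ((StdForm.antidiagonal 3).over L)))
  have hc : IsCMField.complexConj L * IsCMField.complexConj L = 1 := AlgEquiv.ext fun x => IsCMField.complexConj_apply_apply L x
  have hc1 : IsCMField.complexConj L ≠ 1 := IsCMField.complexConj_ne_one L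
  haveI : ν.IsInvInvariant := isInvInvariant_of_isHaarMeasure_adelicUnipotent_three hc ν
  have hBK := exists_mem_borelAdelic_mul_mem_standardMaximalCompactGL_cm_three L
  have hMnn : 0 ≤ M := (norm_nonneg _).trans (hφM 1)
  -- the extreme real parts `σ₁ ≤ Re z ≤ σ₂` on the compact `K`, both `> 2`
  obtain ⟨z₁, hz₁K, hz₁⟩ := hK.exists_isMinOn hKne Complex.continuous_re.continuousOn
  obtain ⟨z₂, hz₂K, hz₂⟩ := hK.exists_isMaxOn hKne Complex.continuous_re.continuousOn
  have hσ₁ : 2 < z₁.re := hK2 hz₁K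
  have hσ₂ : 2 < z₂.re := hK2 hz₂K
  -- the two Gindikin–Karpelevich constants `c(σ_j) = ∫ H(w₀ v)^{σ_j} dν ≥ 0`
  set cGK : ℝ → ℝ := fun σ => ∫ v : ↥(adelicUnipotent (↥(maximalRealSubfield L)) L (IsCMField.complexConj L) 3),
      (borelHeight ((quasiSplit (↥(maximalRealSubfield L)) L (IsCMField.complexConj L) 3).toAdelic (weylLongU ((IsCMField.complexConj L : L ≃ₐ[↥(maximalRealSubfield L)] L) : L →+* L) (rfl : (StdForm.antidiagonal 3).over L = (StdForm.antidiagonal 3).over L)) *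
        (v : (quasiSplit (↥(maximalRealSubfield L)) L (IsCMField.complexConj L) 3).Adelic)) : ℝ) ^ σ ∂ν with hcGK
  have hcnn : ∀ σ, 0 ≤ cGK σ := fun σ => integral_nonneg fun v => Real.rpow_nonneg (NNReal.coe_nonneg _) _
  refine ⟨(ν 𝓕).toReal⁻¹ * (M * (cGK z₁.re + cGK z₂.re)), fun z hzK g hTg => ?_⟩
  have hz : 2 < z.re := hK2 hzK
  have h1z : z₁.re ≤ z.re := hz₁ hzK
  have hz2 : z.re ≤ z₂.re := hz₂ hzK
  have hTpos : (0 : ℝ) < (T : ℝ) := by exact_mod_cast zero_lt_one.trans_le hT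
  have hHge1 : (1 : ℝ) ≤ (borelHeight g : ℝ) := by exact_mod_cast hT.trans hTg.le
  -- Godement finiteness of the standard sections `H^w` at any `g′`, `Re w > 2`, hence integrability of `v ↦ H(w₀ v g′)^{Re w}`
  have hfB1 : ∀ w : ℂ, ∀ b ∈ borelU ((IsCMField.complexConj L : L ≃ₐ[↥(maximalRealSubfield L)] L) : L →+* L) ((StdForm.antidiagonal 3).over L), ∀ x : (quasiSplit (↥(maximalRealSubfield L)) L (IsCMField.complexConj L) 3).Adelic,
      flatSectionU (fun _ : (quasiSplit (↥(maximalRealSubfield L)) L (IsCMField.complexConj L) 3).Adelic => (1 : ℂ)) w ((quasiSplit (↥(maximalRealSubfield L)) L (IsCMField.complexConj L) 3).toAdelic b * x) =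
        flatSectionU (fun _ : (quasiSplit (↥(maximalRealSubfield L)) L (IsCMField.complexConj L) 3).Adelic => (1 : ℂ)) w x :=
    fun w => forall_arithmeticBorel_iff.1 fun b hb x => by rw [flatSectionU_apply, flatSectionU_apply, K2E1TruncatedEisensteinExplicit.borelHeight_arithmeticBorel_mul hb]
  have hI : ∀ {w : ℂ}, 2 < w.re → ∀ g' : (quasiSplit (↥(maximalRealSubfield L)) L (IsCMField.complexConj L) 3).Adelic,
      Integrable (fun v : ↥(adelicUnipotent (↥(maximalRealSubfield L)) L (IsCMField.complexConj L) 3) => (borelHeight ((quasiSplit (↥(maximalRealSubfield L)) L (IsCMField.complexConj L) 3).toAdelic (weylLongU ((IsCMField.complexConj L : L ≃ₐ[↥(maximalRealSubfield L)] L) : L →+* L) (rfl : (StdForm.antidiagonal 3).over L = (StdForm.antidiagonal 3).over L)) *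
        ((v : (quasiSplit (↥(maximalRealSubfield L)) L (IsCMField.complexConj L) 3).Adelic) * g')) : ℝ) ^ w.re) ν := fun {w} hw g' =>
    integrable_borelHeight_weylLongU_mul_rpow ν h𝓕N w g' (hfin_of_locallyUniformMajorant ν (hfB1 w) (fun q => (continuous_flatSectionU continuous_const w).comp (continuous_const.mul continuous_id))
      (exists_locallyUniform_majorant_flatSectionU_cm_three L hw (φ := fun _ : (quasiSplit (↥(maximalRealSubfield L)) L (IsCMField.complexConj L) 3).Adelic => (1 : ℂ)) (M := ‖(1 : ℂ)‖) (fun x => le_rfl)) h𝓕c g')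
  -- `c(Re z) ≤ c(σ₁) + c(σ₂)` (★ `rpow_le_rpow_add_rpow` under the integral at `g′ = 1`)
  have hcle : cGK z.re ≤ cGK z₁.re + cGK z₂.re := by
    have h₁ := hI (w := ((z₁.re : ℝ) : ℂ)) (by rwa [Complex.ofReal_re]) 1
    have h₂ := hI (w := ((z₂.re : ℝ) : ℂ)) (by rwa [Complex.ofReal_re]) 1
    simp only [mul_one, Complex.ofReal_re] at h₁ h₂
    rw [hcGK]
    dsimp only
    rw [← integral_add h₁ h₂]
    refine integral_mono_of_nonneg (Eventually.of_forall fun v => Real.rpow_nonneg (NNReal.coe_nonneg _) _) (h₁.add h₂) (Eventually.of_forall fun v => ?_)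
    exact rpow_le_rpow_add_rpow (by exact_mod_cast borelHeight_pos _) h1z hz2
  -- `|f_z(w₀ v g)| ≤ M · H(w₀ v g)^{Re z}`
  have hle : ∀ v : ↥(adelicUnipotent (↥(maximalRealSubfield L)) L (IsCMField.complexConj L) 3),
      ‖flatSectionU φ z ((quasiSplit (↥(maximalRealSubfield L)) L (IsCMField.complexConj L) 3).toAdelic (weylLongU ((IsCMField.complexConj L : L ≃ₐ[↥(maximalRealSubfield L)] L) : L →+* L) (rfl : (StdForm.antidiagonal 3).over L = (StdForm.antidiagonal 3).over L)) *
        ((v : (quasiSplit (↥(maximalRealSubfield L)) L (IsCMField.complexConj L) 3).Adelic) * g))‖ ≤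
        M * (borelHeight ((quasiSplit (↥(maximalRealSubfield L)) L (IsCMField.complexConj L) 3).toAdelic (weylLongU ((IsCMField.complexConj L : L ≃ₐ[↥(maximalRealSubfield L)] L) : L →+* L) (rfl : (StdForm.antidiagonal 3).over L = (StdForm.antidiagonal 3).over L)) *
          ((v : (quasiSplit (↥(maximalRealSubfield L)) L (IsCMField.complexConj L) 3).Adelic) * g)) : ℝ) ^ z.re := fun v => by
    have hp : (0 : ℝ) < (borelHeight ((quasiSplit (↥(maximalRealSubfield L)) L (IsCMField.complexConj L) 3).toAdelic (weylLongU ((IsCMField.complexConj L : L ≃ₐ[↥(maximalRealSubfield L)] L) : L →+* L) (rfl : (StdForm.antidiagonal 3).over L = (StdForm.antidiagonal 3).over L)) *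
        ((v : (quasiSplit (↥(maximalRealSubfield L)) L (IsCMField.complexConj L) 3).Adelic) * g)) : ℝ) := by exact_mod_cast borelHeight_pos _
    rw [flatSectionU_apply, norm_mul, Complex.norm_cpow_eq_rpow_re_of_pos hp]
    exact mul_le_mul_of_nonneg_right (hφM _) (Real.rpow_nonneg hp.le _)
  -- `‖∫ f_z(w₀ v g) dν‖ ≤ M · c(Re z) · H(g)^{2 − Re z} ≤ M · (c(σ₁) + c(σ₂))`
  have hM : ‖∫ v : ↥(adelicUnipotent (↥(maximalRealSubfield L)) L (IsCMField.complexConj L) 3),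
      flatSectionU φ z ((quasiSplit (↥(maximalRealSubfield L)) L (IsCMField.complexConj L) 3).toAdelic (weylLongU ((IsCMField.complexConj L : L ≃ₐ[↥(maximalRealSubfield L)] L) : L →+* L) (rfl : (StdForm.antidiagonal 3).over L = (StdForm.antidiagonal 3).over L)) *
        ((v : (quasiSplit (↥(maximalRealSubfield L)) L (IsCMField.complexConj L) 3).Adelic) * g)) ∂ν‖ ≤ M * (cGK z.re * (borelHeight g : ℝ) ^ (2 - z.re)) := by
    rw [hcGK]
    dsimp only
    rw [← integral_borelHeight_weylLongU_mul_rpow_eq hc hc1 ν hBK z.re g, ← integral_const_mul]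
    exact norm_integral_le_of_norm_le ((hI hz g).const_mul M) (Eventually.of_forall hle)
  have hH : (borelHeight g : ℝ) ^ (2 - z.re) ≤ 1 := Real.rpow_le_one_of_one_le_of_nonpos hHge1 (by linarith)
  have hM' : ‖∫ v : ↥(adelicUnipotent (↥(maximalRealSubfield L)) L (IsCMField.complexConj L) 3),
      flatSectionU φ z ((quasiSplit (↥(maximalRealSubfield L)) L (IsCMField.complexConj L) 3).toAdelic (weylLongU ((IsCMField.complexConj L : L ≃ₐ[↥(maximalRealSubfield L)] L) : L →+* L) (rfl : (StdForm.antidiagonal 3).over L = (StdForm.antidiagonal 3).over L)) *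
        ((v : (quasiSplit (↥(maximalRealSubfield L)) L (IsCMField.complexConj L) 3).Adelic) * g)) ∂ν‖ ≤ M * (cGK z₁.re + cGK z₂.re) := by
    refine hM.trans (mul_le_mul_of_nonneg_left ?_ hMnn)
    calc cGK z.re * (borelHeight g : ℝ) ^ (2 - z.re) ≤ cGK z.re * 1 := mul_le_mul_of_nonneg_left hH (hcnn _)
      _ = cGK z.re := mul_one _
      _ ≤ cGK z₁.re + cGK z₂.re := hcle
  -- the Bruhat-unfolded constant term ★
  rw [borelConstantTerm_eisensteinSeriesU_flatSectionU_cm_three L ν h𝓕N h𝓕c hφc hφM hφN hφB hz g, add_sub_cancel_left, norm_smul, Real.norm_eq_abs,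
    abs_of_nonneg (inv_nonneg.2 ENNReal.toReal_nonneg)]
  simp_rw [mul_assoc ((quasiSplit (↥(maximalRealSubfield L)) L (IsCMField.complexConj L) 3).toAdelic (weylLongU ((IsCMField.complexConj L : L ≃ₐ[↥(maximalRealSubfield L)] L) : L →+* L) (rfl : (StdForm.antidiagonal 3).over L = (StdForm.antidiagonal 3).over L)))]
  exact mul_le_mul_of_nonneg_left hM' (inv_nonneg.2 ENNReal.toReal_nonneg)

/-- **`hMfU` FOR A `(χ₁, χ₂)`-PAIR SECTION** `φ_ξ` (★ `IsChiSectionPair χ₁ χ₂ φ_ξ`, `χ₂` automorphic; continuous, `‖φ_ξ‖ ≤ M`; `1 ≤ T`) — §1 with ★ `IsChiSectionPair.unipotent_mul` ∕ ★ `.toAdelic_mul`.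
[cite: MoeglinWaldspurger1995, II.1.7] [cite: Rogawski1990, §13.9 p. 229] -/
theorem hMfU_pair_cm_three (ν : Measure ↥(adelicUnipotent (↥(maximalRealSubfield L)) L (IsCMField.complexConj L) 3)) [ν.IsHaarMeasure]
    {𝓕 : Set ↥(adelicUnipotent (↥(maximalRealSubfield L)) L (IsCMField.complexConj L) 3)} (h𝓕N : IsFundamentalDomain ↥(rationalUnipotent (↥(maximalRealSubfield L)) L (IsCMField.complexConj L) 3) 𝓕 ν) (h𝓕c : IsCompact (closure 𝓕))
    {χ₁ : HeckeCharacter L} {χ₂ : ↥(TorusDict.torus (IsCMField.complexConj L)) →ₜ* ℂˣ} (hχ₂ : TorusDict.IsAutomorphic (IsCMField.complexConj L) χ₂)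
    {φξ : (quasiSplit (↥(maximalRealSubfield L)) L (IsCMField.complexConj L) 3).Adelic → ℂ} (hφξ : IsChiSectionPair χ₁ χ₂ φξ) (hφc : Continuous φξ) {M : ℝ} (hφM : ∀ x, ‖φξ x‖ ≤ M)
    {T : ℝ≥0} (hT : 1 ≤ T) :
    ∀ K : Set ℂ, IsCompact K → K ⊆ {z : ℂ | 2 < z.re} → ∃ C' : ℝ, ∀ z ∈ K, ∀ g : (quasiSplit (↥(maximalRealSubfield L)) L (IsCMField.complexConj L) 3).Adelic, T < borelHeight g →
      ‖borelConstantTerm ν 𝓕 (eisensteinSeriesU (flatSectionU φξ z)) g - flatSectionU φξ z g‖ ≤ C' :=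
  hMfU_level_cm_three L ν h𝓕N h𝓕c hφc hφM hφξ.unipotent_mul (hφξ.toAdelic_mul hχ₂) hT

end Summit.HodgeConjecture.HodgeConjecture.Cruxes.H413.K2E1EisensteinConstantTermIntertwinedBoundUniformU3

end
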